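import Literature.NumberTheory.Sieve.MatomakiRadziwillProp1Inputs
import Literature.NumberTheory.Sieve.MatomakiRadziwillLemma11Tools
import Literature.NumberTheory.Sieve.MatomakiRadziwillLemma11Kernel
import Literature.NumberTheory.LFunctions.TwistedVonMangoldtSum
import HarnessLib

/-!
# Matomäki–Radziwiłł 2016, Lemma 11 (Halász inequality for primes) from the Vinogradov–Korobov region

Topic `NumberTheory/Sieve`; third and last file of the reduction of the named fact
`Literature.NumberTheory.Sieve.MatomakiRadziwill2016_lemma11` (`MatomakiRadziwillProp1Inputs.lean`) to
Khale's explicit Vinogradov–Korobov zero-free region (`Khale2024_zeroFreeRegion`,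
`VinogradovKorobovDirichlet.lean`):

* `MatomakiRadziwill2016_lemma11_of_vk : 0 < c → HasVKZeroFreeRegion c T₀ → MatomakiRadziwill2016_lemma11`
  (any Vinogradov–Korobov region, explicit or not — the interface of `VinogradovKorobovDirichlet.lean`);
* `MatomakiRadziwill2016_lemma11_of_khale : Khale2024_zeroFreeRegion → MatomakiRadziwill2016_lemma11`
  (its specialisation, `HasVKZeroFreeRegion (1/61.5) 10`).

Lemma 11 (K. Matomäki, M. Radziwiłł, *Multiplicative functions in short intervals*, Ann. of Math. 183
(2016), arXiv pp. 11–12): for `P(s) = ∑_{P ≤ p ≤ 2P} a_p p^{-s}` and a `1`-spaced `𝒯 ⊂ [-T, T]`,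
`∑_{t ∈ 𝒯} |P(it)|² ≪_ε (P + |𝒯| P exp(-log P/(log T)^{2/3+ε}) (log T)²) ∑_p |a_p|²/log P`.

## The argument

As printed: by duality (here in the primal weighted Halász–Montgomery form
`MatomakiRadziwillL11.weighted_halasz_montgomery`, weights `w_n = Λ(n) W_P(n)` with the trapezoid `W_P` of
`MatomakiRadziwillLemma11Kernel.lean`, `= (P/2) log p` on the primes of `[P, 2P]`) it suffices to bound
`∑_{t' ∈ 𝒯} |K(t - t')|`, `K(τ) = ∑_n Λ(n) W_P(n) n^{-iτ}`; the kernel is a signed combination of four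
Riesz means of `b(n) = Λ(n) n^{-iτ}`, evaluated by the tree's Landau–Riesz contour engine
(`TwistedRieszMean`, hypotheses `TwistData` supplied at scale `X` by
`TwistedVonMangoldt.exists_twistData` from Khale's theorem, i.e. `-ζ₁'/ζ₁ ≪ (log X)³` and no zeros on
`σ ≥ 1 - (log X)^{-η}/2`, `|t| ≤ 2X`): `|K(τ)| ≤ (23/2)P² (1/(1+τ²) + U)` with
`U = (2 log P + 2 + K₀)/X + 2C(log X)³ (P/2)^{-(log X)^{-η}/2} + 2C(log X)³/X²`
(`MatomakiRadziwillL11.norm_sum_trapW_le`).  The off-diagonal decay `1/(1 + τ²)` sums to `≤ 6` over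
`𝒯` (`sum_inv_one_add_sq_le`), whence
`∑_t |P(it)|² ≤ 23 P (6 + |𝒯| U) ∑_p |a_p|²/log P` (`MatomakiRadziwillL11.dirichlet_bound`).
With the scale `X ≍ T log P` and `η = 2/3 + ε'/2`, `ε' = min(ε, 1/2)`, the error `U` is `≤ 1/T` plus
`2C (log X)³ exp(-log(P/2)/(2 (log X)^η))`, which is `≤ (54C+1)(log T)² exp(-log P/(log T)^{2/3+ε})` when
`log P ≤ T` and `≤ 1/T` when `log P > T`, for `T` large and outside the trivial range
`exp(-log P/(log T)^{2/3+ε})(log T)² ≥ 1` — where, as for bounded `T`, the claim follows from Chebyshev's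
bound alone (`MatomakiRadziwillL11.trivial_bound`).  The printed proof uses a smooth bump and the
region `σ ≥ 1 - c(log T)^{-2/3-ε}` at height `T`; the Riesz trapezoid has Mellin decay of order `2`
only, which is why the scale `X` (hence the region) is taken slightly larger than `T` here — the
statement proved is exactly the printed one.

## References

* K. Matomäki, M. Radziwiłł, Ann. of Math. (2) 183 (2016), 1015–1056, doi:10.4007/annals.2016.183.3.6,
  Lemma 11 (arXiv:1501.04585, pp. 11–12). [MatomakiRadziwillAnnals2016]
* T. Khale, *An explicit Vinogradov–Korobov zero-free region for Dirichlet L-functions*, Q. J. Math.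
  75 (2024), Theorem 1.1. [Khale2024]
-/

noncomputable section

open Finset Complex Filter
open scoped ArithmeticFunction.vonMangoldt
open Literature.NumberTheory.LFunctions
open Literature.NumberTheory.LFunctions.TwistedRieszMean

namespace Literature.NumberTheory.Sieve

namespace MatomakiRadziwillL11

/-! ### The kernel of the weights `Λ(n) W_P(n)` -/

/-- For the level-one character, `twist 1 τ n = Λ(n) n^{-iτ}`. [folklore] -/
theorem twist_one_eq (τ : ℝ) (n : ℕ) :
    TwistedVonMangoldt.twist (1 : DirichletCharacter ℂ 1) τ n = (Λ n : ℂ) * (n : ℂ) ^ (-(τ * I)) := by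
  rw [TwistedVonMangoldt.twist, MulChar.one_apply (isUnit_of_subsingleton _), one_mul]

/-- `δ_χ = 1` for the level-one character. [folklore] -/
theorem delta_one_eq : TwistedVonMangoldt.delta (1 : DirichletCharacter ℂ 1) = 1 := by
  simp [TwistedVonMangoldt.delta]

/-- The weighted kernel of `w_n = Λ(n) W_P(n)` is the trapezoid sum of the twisted coefficients:
`∑_{1 ≤ n ≤ N} Λ(n) W_P(n) n^{-iτ} = ∑_{0 < n ≤ N} (Λ(n) n^{-iτ}) W_P(n)`. [folklore] -/
theorem wkernel_eq_sum_twist (P τ : ℝ) (N : ℕ) :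
    wkernel (Icc 1 N) (fun n => Λ n * trapW P n) τ =
      ∑ n ∈ Ioc 0 N, TwistedVonMangoldt.twist (1 : DirichletCharacter ℂ 1) τ n * (trapW P n : ℂ) := by
  have hI : Icc 1 N = Ioc 0 N := by
    ext n; simp only [Finset.mem_Icc, Finset.mem_Ioc]; omega
  rw [wkernel, hI]
  refine Finset.sum_congr rfl fun n _ => ?_
  rw [twist_one_eq]
  push_cast
  ring

/-- **The kernel bound at a scale.**  If the twisted coefficients `Λ(n) n^{-iτ}` carry `TwistData` on
the rectangle `[σ₁, 2] × [-X, X]` with bound `B` (as supplied by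
`TwistedVonMangoldt.exists_twistData`), then for `P ≥ 16` and `N ≥ ⌊5P/2⌋`
`‖K(τ)‖ ≤ (23/2) P² (1/(1 + τ²) + (2 log P + 2 + K₀)/X + 2B(P/2)^{σ₁-1} + 2B/X²)`.
[cite: MatomakiRadziwillAnnals2016, Lemma 11 (proof)] -/
theorem norm_wkernel_le {τ σ₁ X B K₀ P : ℝ} {N : ℕ}
    (hTD : TwistData (TwistedVonMangoldt.twist (1 : DirichletCharacter ℂ 1) τ)
      (TwistedVonMangoldt.G (1 : DirichletCharacter ℂ 1) τ)
      (TwistedVonMangoldt.delta (1 : DirichletCharacter ℂ 1)) (1 - τ * I) σ₁ X B)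
    (hK₀ : 0 ≤ K₀)
    (hK : ∀ (b : ℕ → ℂ), (∀ n, ‖b n‖ ≤ Λ n) → ∀ s : ℂ, 1 < s.re → s.re ≤ 2 →
      ‖LSeries b s‖ ≤ 1 / (s.re - 1) + K₀)
    (hP : 16 ≤ P) (hN : ⌊5 * P / 2⌋₊ ≤ N) :
    ‖wkernel (Icc 1 N) (fun n => Λ n * trapW P n) τ‖ ≤
      23 / 2 * P ^ 2 * (1 / (1 + τ ^ 2)
        + ((2 * Real.log P + 2 + K₀) / X + 2 * B * (P / 2) ^ (σ₁ - 1) + 2 * B / X ^ 2)) := by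
  rw [wkernel_eq_sum_twist]
  refine (norm_sum_trapW_le hTD hK₀ hK hP hN).trans ?_
  have h1 : 1 / ‖(1 - τ * I) * (1 - τ * I + 1)‖ ≤ 1 / (1 + τ ^ 2) :=
    one_div_le_one_div_of_le (by positivity) (sq_add_one_le_norm τ)
  have hP2 : 0 ≤ 23 / 2 * P ^ 2 := by positivity
  exact mul_le_mul_of_nonneg_left (by linarith) hP2

/-- **Summing the kernel bound over a well-spaced set.**  If `TwistData` holds for every shift
`τ = t - t'`, `t, t' ∈ 𝒯` (a `1`-spaced set), then for every `t ∈ 𝒯`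
`∑_{t' ∈ 𝒯} ‖K(t - t')‖ ≤ (23/2) P² (6 + #𝒯 · U)`, `U` the `τ`-independent part of the bound.
[cite: MatomakiRadziwillAnnals2016, Lemma 11 (proof)] -/
theorem sum_norm_wkernel_le {σ₁ X B K₀ P : ℝ} {N : ℕ} {𝒯 : Finset ℝ}
    (hsep : ∀ t ∈ 𝒯, ∀ t' ∈ 𝒯, t ≠ t' → 1 ≤ |t - t'|)
    (hTD : ∀ t ∈ 𝒯, ∀ t' ∈ 𝒯,
      TwistData (TwistedVonMangoldt.twist (1 : DirichletCharacter ℂ 1) (t - t'))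
        (TwistedVonMangoldt.G (1 : DirichletCharacter ℂ 1) (t - t'))
        (TwistedVonMangoldt.delta (1 : DirichletCharacter ℂ 1)) (1 - ((t - t' : ℝ) : ℂ) * I) σ₁ X B)
    (hK₀ : 0 ≤ K₀)
    (hK : ∀ (b : ℕ → ℂ), (∀ n, ‖b n‖ ≤ Λ n) → ∀ s : ℂ, 1 < s.re → s.re ≤ 2 →
      ‖LSeries b s‖ ≤ 1 / (s.re - 1) + K₀)
    (hP : 16 ≤ P) (hN : ⌊5 * P / 2⌋₊ ≤ N)
    {U : ℝ} (hU : (2 * Real.log P + 2 + K₀) / X + 2 * B * (P / 2) ^ (σ₁ - 1) + 2 * B / X ^ 2 ≤ U)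
    {t : ℝ} (ht : t ∈ 𝒯) :
    ∑ t' ∈ 𝒯, ‖wkernel (Icc 1 N) (fun n => Λ n * trapW P n) (t - t')‖ ≤
      23 / 2 * P ^ 2 * (6 + (#𝒯 : ℝ) * U) := by
  have hP2 : 0 ≤ 23 / 2 * P ^ 2 := by positivity
  have hterm : ∀ t' ∈ 𝒯, ‖wkernel (Icc 1 N) (fun n => Λ n * trapW P n) (t - t')‖ ≤
      23 / 2 * P ^ 2 * (1 / (1 + (t - t') ^ 2) + U) := by
    intro t' ht'
    refine (norm_wkernel_le (hTD t ht t' ht') hK₀ hK hP hN).trans ?_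
    exact mul_le_mul_of_nonneg_left (by linarith) hP2
  calc ∑ t' ∈ 𝒯, ‖wkernel (Icc 1 N) (fun n => Λ n * trapW P n) (t - t')‖
      ≤ ∑ t' ∈ 𝒯, 23 / 2 * P ^ 2 * (1 / (1 + (t - t') ^ 2) + U) := Finset.sum_le_sum hterm
    _ = 23 / 2 * P ^ 2 * (∑ t' ∈ 𝒯, 1 / (1 + (t - t') ^ 2) + (#𝒯 : ℝ) * U) := by
        rw [← Finset.mul_sum, Finset.sum_add_distrib, Finset.sum_const, nsmul_eq_mul]
    _ ≤ 23 / 2 * P ^ 2 * (6 + (#𝒯 : ℝ) * U) := by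
        gcongr
        exact sum_inv_one_add_sq_le hsep t

/-- **The Dirichlet-polynomial bound before the choice of parameters**: under the hypotheses of
`sum_norm_wkernel_le`,
`∑_{t ∈ 𝒯} |∑_{P ≤ p ≤ 2P} a_p p^{-it}|² ≤ 23 P (6 + #𝒯 · U) ∑_p |a_p|²/log P`
(weighted Halász–Montgomery with `w_n = Λ(n) W_P(n)`, `= (P/2) log p ≥ (P/2) log P` on the primes of
`[P, 2P]`). [cite: MatomakiRadziwillAnnals2016, Lemma 11 (proof)] -/
theorem dirichlet_bound {σ₁ X B K₀ P : ℝ} {𝒯 : Finset ℝ}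
    (hsep : ∀ t ∈ 𝒯, ∀ t' ∈ 𝒯, t ≠ t' → 1 ≤ |t - t'|)
    (hTD : ∀ t ∈ 𝒯, ∀ t' ∈ 𝒯,
      TwistData (TwistedVonMangoldt.twist (1 : DirichletCharacter ℂ 1) (t - t'))
        (TwistedVonMangoldt.G (1 : DirichletCharacter ℂ 1) (t - t'))
        (TwistedVonMangoldt.delta (1 : DirichletCharacter ℂ 1)) (1 - ((t - t' : ℝ) : ℂ) * I) σ₁ X B)
    (hK₀ : 0 ≤ K₀)
    (hK : ∀ (b : ℕ → ℂ), (∀ n, ‖b n‖ ≤ Λ n) → ∀ s : ℂ, 1 < s.re → s.re ≤ 2 →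
      ‖LSeries b s‖ ≤ 1 / (s.re - 1) + K₀)
    (hP : 16 ≤ P)
    {U : ℝ} (hU0 : 0 ≤ U)
    (hU : (2 * Real.log P + 2 + K₀) / X + 2 * B * (P / 2) ^ (σ₁ - 1) + 2 * B / X ^ 2 ≤ U)
    (a : ℕ → ℂ) :
    ∑ t ∈ 𝒯, ‖∑ p ∈ (Icc ⌈P⌉₊ ⌊2 * P⌋₊).filter Nat.Prime, a p * (p : ℂ) ^ (-((t : ℂ) * I))‖ ^ 2 ≤
      23 * P * (6 + (#𝒯 : ℝ) * U) *
        ∑ p ∈ (Icc ⌈P⌉₊ ⌊2 * P⌋₊).filter Nat.Prime, ‖a p‖ ^ 2 / Real.log P := by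
  classical
  have hP0 : 0 < P := by linarith
  have hP1 : 1 < P := by linarith
  have hlogP : 0 < Real.log P := Real.log_pos hP1
  set N : ℕ := ⌊5 * P / 2⌋₊ with hNdef
  set S := (Icc ⌈P⌉₊ ⌊2 * P⌋₊).filter Nat.Prime with hS
  set w : ℕ → ℝ := fun n => Λ n * trapW P n with hw
  -- the hypotheses of the weighted Halász–Montgomery inequality
  have hSS' : S ⊆ Icc 1 N := by
    intro p hp
    rw [hS, Finset.mem_filter, Finset.mem_Icc] at hp
    rw [Finset.mem_Icc]
    refine ⟨hp.2.one_le, hp.1.2.trans (Nat.floor_le_floor (by linarith))⟩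
  have hS'0 : ∀ n ∈ Icc 1 N, n ≠ 0 := fun n hn => by
    have := (Finset.mem_Icc.1 hn).1; omega
  have hw0 : ∀ n ∈ Icc 1 N, 0 ≤ w n := fun n _ =>
    mul_nonneg ArithmeticFunction.vonMangoldt_nonneg (trapW_nonneg hP0.le n)
  have hmemS : ∀ p ∈ S, p.Prime ∧ P ≤ p ∧ (p : ℝ) ≤ 2 * P := by
    intro p hp
    rw [hS, Finset.mem_filter, Finset.mem_Icc] at hp
    refine ⟨hp.2, le_trans (Nat.le_ceil P) (by exact_mod_cast hp.1.1), ?_⟩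
    exact le_trans (by exact_mod_cast hp.1.2) (Nat.floor_le (by linarith))
  have hwS : ∀ p ∈ S, w p = Real.log p * (P / 2) := by
    intro p hp
    obtain ⟨hpp, h1, h2⟩ := hmemS p hp
    simp only [hw]
    rw [ArithmeticFunction.vonMangoldt_apply_prime hpp, trapW_eq_half h1 h2]
  have hwpos : ∀ p ∈ S, 0 < w p := by
    intro p hp
    rw [hwS p hp]
    have : (2 : ℝ) ≤ p := by exact_mod_cast (hmemS p hp).1.two_le
    exact mul_pos (Real.log_pos (by linarith)) (by linarith)
  -- the kernel bound
  set Bk : ℝ := 23 / 2 * P ^ 2 * (6 + (#𝒯 : ℝ) * U) with hBk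
  have hBk0 : 0 ≤ Bk := by rw [hBk]; positivity
  have hker : ∀ t ∈ 𝒯, ∑ t' ∈ 𝒯, ‖wkernel (Icc 1 N) w (t - t')‖ ≤ Bk := fun t ht =>
    sum_norm_wkernel_le hsep hTD hK₀ hK hP le_rfl hU ht
  have hHM := weighted_halasz_montgomery S (Icc 1 N) hSS' hS'0 w hw0 hwpos a 𝒯 hBk0 hker
  refine hHM.trans ?_
  -- compare the weights with `(P/2) log P`
  have hcmp : ∑ p ∈ S, ‖a p‖ ^ 2 / w p ≤ ∑ p ∈ S, ‖a p‖ ^ 2 / Real.log P * (2 / P) := by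
    refine Finset.sum_le_sum fun p hp => ?_
    obtain ⟨hpp, h1, h2⟩ := hmemS p hp
    have hlogp : Real.log P ≤ Real.log p := Real.log_le_log hP0 h1
    have hPne : P ≠ 0 := hP0.ne'
    have hlogPne : Real.log P ≠ 0 := hlogP.ne'
    have heq : ‖a p‖ ^ 2 / Real.log P * (2 / P) = ‖a p‖ ^ 2 / (Real.log P * (P / 2)) := by
      field_simp
    rw [hwS p hp, heq]
    exact div_le_div_of_nonneg_left (sq_nonneg _) (mul_pos hlogP (by linarith))
      (mul_le_mul_of_nonneg_right hlogp (by linarith))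
  rw [← Finset.sum_mul] at hcmp
  have hPne : P ≠ 0 := hP0.ne'
  have hlogPne : Real.log P ≠ 0 := hlogP.ne'
  calc Bk * ∑ p ∈ S, ‖a p‖ ^ 2 / w p
      ≤ Bk * ((∑ p ∈ S, ‖a p‖ ^ 2 / Real.log P) * (2 / P)) :=
        mul_le_mul_of_nonneg_left hcmp hBk0
    _ = 23 * P * (6 + (#𝒯 : ℝ) * U) * ∑ p ∈ S, ‖a p‖ ^ 2 / Real.log P := by
        rw [hBk]; field_simp

/-! ### Elementary inequalities for the choice of parameters -/

/-- `log(max(X₃, 2TL)) ≤ log X₃ + log 2 + log T + log L` for `X₃, T, L ≥ 1`. [folklore] -/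
theorem log_scale_le {X₃ T L : ℝ} (hX₃ : 1 ≤ X₃) (hT : 1 ≤ T) (hL : 1 ≤ L) :
    Real.log (max X₃ (2 * T * L)) ≤ Real.log X₃ + Real.log 2 + Real.log T + Real.log L := by
  have h2TL : 1 ≤ 2 * T * L := by nlinarith
  have hle : max X₃ (2 * T * L) ≤ X₃ * (2 * T * L) :=
    max_le (le_mul_of_one_le_right (by linarith) h2TL) (le_mul_of_one_le_left (by positivity) hX₃)
  have hpos : 0 < max X₃ (2 * T * L) := lt_of_lt_of_le one_pos (le_max_of_le_left hX₃)
  calc Real.log (max X₃ (2 * T * L)) ≤ Real.log (X₃ * (2 * T * L)) := Real.log_le_log hpos hle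
    _ = Real.log X₃ + Real.log 2 + Real.log T + Real.log L := by
        rw [Real.log_mul (by positivity) (by positivity), Real.log_mul (by positivity) (by positivity),
          Real.log_mul (by norm_num) (by positivity)]
        ring

/-- `log(2 log P + 2 + K₀) ≤ log(4 + K₀) + log log P` when `log P ≥ 1`, `K₀ ≥ 0`. [folklore] -/
theorem log_LP_le {lP K₀ : ℝ} (hlP : 1 ≤ lP) (hK₀ : 0 ≤ K₀) :
    Real.log (2 * lP + 2 + K₀) ≤ Real.log (4 + K₀) + Real.log lP := by
  have hle : 2 * lP + 2 + K₀ ≤ (4 + K₀) * lP := by nlinarith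
  calc Real.log (2 * lP + 2 + K₀) ≤ Real.log ((4 + K₀) * lP) := Real.log_le_log (by positivity) hle
    _ = Real.log (4 + K₀) + Real.log lP := Real.log_mul (by positivity) (by positivity)

/-- The saving `(P/2)^{σ₁ - 1}` in exponential form: `(P/2)^{(1 - y/2) - 1} = exp(-(log(P/2) · y/2))`.
[folklore] -/
theorem rpow_sigma_eq {P y : ℝ} (hP : 0 < P) :
    (P / 2) ^ ((1 - y / 2) - 1) = Real.exp (-(Real.log (P / 2) * (y / 2))) := by
  rw [Real.rpow_def_of_pos (by positivity)]
  congr 1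
  ring

/-- **The saving when `log P ≤ T`**: if `log X ≤ 3 log T` (`log T ≥ 1`), then
`exp(-(log(P/2) (log X)^{-η}/2)) ≤ exp(-(log P/(12 (log T)^η)))` for `P ≥ 4`, `0 < η ≤ 1`. [folklore] -/
theorem saving_case_i {P lX lT η : ℝ} (hP : 4 ≤ P) (hlX1 : 1 ≤ lX) (hlX : lX ≤ 3 * lT) (hlT : 1 ≤ lT)
    (hη0 : 0 < η) (hη1 : η ≤ 1) :
    Real.exp (-(Real.log (P / 2) * (lX ^ (-η) / 2))) ≤
      Real.exp (-(Real.log P / (12 * lT ^ η))) := by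
  rw [Real.exp_le_exp, neg_le_neg_iff]
  have hlP2 : Real.log P / 2 ≤ Real.log (P / 2) := by
    rw [Real.log_div (by linarith) (by norm_num)]
    have h4 : Real.log 4 ≤ Real.log P := Real.log_le_log (by norm_num) hP
    have : Real.log 4 = 2 * Real.log 2 := by
      rw [show (4 : ℝ) = 2 ^ 2 by norm_num, Real.log_pow]; ring
    linarith
  have hlP0 : 0 ≤ Real.log P := Real.log_nonneg (by linarith)
  have hlT0 : 0 < lT := by linarith
  -- `(lX)^{-η} ≥ (3 lT)^{-η} ≥ 1/(3 lT^η)`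
  have h1 : (3 * lT) ^ (-η) ≤ lX ^ (-η) :=
    Real.rpow_le_rpow_of_nonpos (by linarith) hlX (by linarith)
  have h2 : (3 * lT) ^ η ≤ 3 * lT ^ η := by
    rw [Real.mul_rpow (by norm_num) hlT0.le]
    have : (3 : ℝ) ^ η ≤ 3 := by
      conv_rhs => rw [← Real.rpow_one 3]
      exact Real.rpow_le_rpow_of_exponent_le (by norm_num) hη1
    exact mul_le_mul_of_nonneg_right this (by positivity)
  have h3 : 1 / (3 * lT ^ η) ≤ (3 * lT) ^ (-η) := by
    rw [Real.rpow_neg (by positivity), ← one_div]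
    exact one_div_le_one_div_of_le (by positivity) h2
  have h4 : 1 / (3 * lT ^ η) ≤ lX ^ (-η) := h3.trans h1
  calc Real.log P / (12 * lT ^ η) = Real.log P / 2 * (1 / (3 * lT ^ η) / 2) := by
        field_simp; ring
    _ ≤ Real.log (P / 2) * (lX ^ (-η) / 2) := by
        apply mul_le_mul hlP2 (by linarith) (by positivity)
        linarith

/-- **The saving when `log P > T`**: if `log X ≤ 3 log log P` (`3 log log P ≥ 1`), then
`exp(-(log(P/2) (log X)^{-η}/2)) ≤ exp(-(log P/(12 log log P)))` for `P ≥ 4`, `0 < η ≤ 1`. [folklore] -/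
theorem saving_case_ii {P lX llP η : ℝ} (hP : 4 ≤ P) (hlX1 : 1 ≤ lX) (hlX : lX ≤ 3 * llP)
    (hllP : 1 ≤ 3 * llP) (hη0 : 0 < η) (hη1 : η ≤ 1) :
    Real.exp (-(Real.log (P / 2) * (lX ^ (-η) / 2))) ≤
      Real.exp (-(Real.log P / (12 * llP))) := by
  rw [Real.exp_le_exp, neg_le_neg_iff]
  have hlP2 : Real.log P / 2 ≤ Real.log (P / 2) := by
    rw [Real.log_div (by linarith) (by norm_num)]
    have h4 : Real.log 4 ≤ Real.log P := Real.log_le_log (by norm_num) hP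
    have : Real.log 4 = 2 * Real.log 2 := by
      rw [show (4 : ℝ) = 2 ^ 2 by norm_num, Real.log_pow]; ring
    linarith
  have hlP0 : 0 ≤ Real.log P := Real.log_nonneg (by linarith)
  have hllP0 : 0 < llP := by linarith
  have h1 : (3 * llP) ^ (-η) ≤ lX ^ (-η) :=
    Real.rpow_le_rpow_of_nonpos (by linarith) hlX (by linarith)
  have h2 : (3 * llP) ^ (-(1 : ℝ)) ≤ (3 * llP) ^ (-η) :=
    Real.rpow_le_rpow_of_exponent_le hllP (by linarith)
  have h3 : (3 * llP) ^ (-(1 : ℝ)) = 1 / (3 * llP) := by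
    rw [Real.rpow_neg (by positivity), Real.rpow_one, one_div]
  have h4 : 1 / (3 * llP) ≤ lX ^ (-η) := by rw [← h3]; exact h2.trans h1
  calc Real.log P / (12 * llP) = Real.log P / 2 * (1 / (3 * llP) / 2) := by
        field_simp; ring
    _ ≤ Real.log (P / 2) * (lX ^ (-η) / 2) := by
        apply mul_le_mul hlP2 (by linarith) (by positivity)
        linarith

/-- **The exponent comparison** behind case (i): with `η = 2/3 + ε'/2`, `ε' ≤ ε`, `(log T)^{ε'/2} ≥ 18`
and `u = log P/(log T)^{2/3+ε} ≥ 0`, one has `(3/2) u ≤ log P/(12 (log T)^η)`. [folklore] -/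
theorem key_exponent_ineq {lP lT ε ε' η u : ℝ} (hlT : 1 ≤ lT) (h18 : 18 ≤ lT ^ (ε' / 2))
    (hη : η = 2 / 3 + ε' / 2) (hε'ε : ε' ≤ ε) (hu : u = lP / lT ^ (2 / 3 + ε)) (hu0 : 0 ≤ u) :
    3 / 2 * u ≤ lP / (12 * lT ^ η) := by
  have hlT0 : 0 < lT := by linarith
  have hpow : 0 < lT ^ (2 / 3 + ε) := Real.rpow_pos_of_pos hlT0 _
  have hlP : lP = u * lT ^ (2 / 3 + ε) := by rw [hu, div_mul_cancel₀ _ hpow.ne']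
  have hδ : lT ^ (ε' / 2) ≤ lT ^ (2 / 3 + ε - η) :=
    Real.rpow_le_rpow_of_exponent_le hlT (by rw [hη]; linarith)
  have h18' : 18 ≤ lT ^ (2 / 3 + ε - η) := h18.trans hδ
  have hsplit : lT ^ (2 / 3 + ε) = lT ^ (2 / 3 + ε - η) * lT ^ η := by
    rw [← Real.rpow_add hlT0]; ring_nf
  have hη0 : 0 < lT ^ η := Real.rpow_pos_of_pos hlT0 _
  rw [hlP, hsplit, show u * (lT ^ (2 / 3 + ε - η) * lT ^ η) / (12 * lT ^ η)
      = u * lT ^ (2 / 3 + ε - η) / 12 by field_simp]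
  nlinarith

/-- **Numerics of case (i)**: from `(3/2)u ≤ log P/(12(log T)^η)` and `2 log log T < u`,
`54 C (log T)³ exp(-log P/(12 (log T)^η)) ≤ (54C + 1)(log T)² e^{-u}`. [folklore] -/
theorem numerics_case_i {C lP lT η u : ℝ} (hC : 0 ≤ C) (hlT : 1 ≤ lT) (hu : 2 * Real.log lT < u)
    (hA : 3 / 2 * u ≤ lP / (12 * lT ^ η)) :
    54 * C * lT ^ 3 * Real.exp (-(lP / (12 * lT ^ η))) ≤ (54 * C + 1) * lT ^ 2 * Real.exp (-u) := by
  have hlT0 : 0 < lT := by linarith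
  have h1 : Real.exp (-(lP / (12 * lT ^ η))) ≤ Real.exp (-(3 / 2 * u)) :=
    Real.exp_le_exp.2 (by linarith)
  have h2 : lT ≤ Real.exp (u / 2) := by
    calc lT = Real.exp (Real.log lT) := (Real.exp_log hlT0).symm
      _ ≤ Real.exp (u / 2) := Real.exp_le_exp.2 (by linarith)
  have h3 : lT * Real.exp (-(3 / 2 * u)) ≤ Real.exp (-u) := by
    calc lT * Real.exp (-(3 / 2 * u)) ≤ Real.exp (u / 2) * Real.exp (-(3 / 2 * u)) :=
          mul_le_mul_of_nonneg_right h2 (Real.exp_pos _).le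
      _ = Real.exp (-u) := by rw [← Real.exp_add]; ring_nf
  calc 54 * C * lT ^ 3 * Real.exp (-(lP / (12 * lT ^ η)))
      ≤ 54 * C * lT ^ 3 * Real.exp (-(3 / 2 * u)) :=
        mul_le_mul_of_nonneg_left h1 (by positivity)
    _ = 54 * C * lT ^ 2 * (lT * Real.exp (-(3 / 2 * u))) := by ring
    _ ≤ 54 * C * lT ^ 2 * Real.exp (-u) := mul_le_mul_of_nonneg_left h3 (by positivity)
    _ ≤ (54 * C + 1) * lT ^ 2 * Real.exp (-u) := by
        have : 0 ≤ lT ^ 2 * Real.exp (-u) := by positivity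
        nlinarith

/-- **Numerics of case (ii)**: for `L = log P` large (`log L ≤ L^{1/4}`, `54 C L^{7/4} ≤ exp(L^{3/4}/12)`),
`54 C (log L)³ exp(-L/(12 log L)) ≤ 1/L`. [folklore] -/
theorem numerics_case_ii {C L : ℝ} (hC : 0 ≤ C) (hL : 1 < L) (hlog : Real.log L ≤ L ^ (1 / 4 : ℝ))
    (hexp : 54 * C * L ^ (7 / 4 : ℝ) ≤ Real.exp (1 / 12 * L ^ (3 / 4 : ℝ))) :
    54 * C * Real.log L ^ 3 * Real.exp (-(L / (12 * Real.log L))) ≤ 1 / L := by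
  have hL0 : 0 < L := by linarith
  have hlog0 : 0 < Real.log L := Real.log_pos hL
  -- `(log L)^3 ≤ L^{3/4}` and `L^{3/4} · L = L^{7/4}`, `L^{3/4} L^{1/4} = L`
  have h34 : Real.log L ^ 3 ≤ L ^ (3 / 4 : ℝ) := by
    calc Real.log L ^ 3 ≤ (L ^ (1 / 4 : ℝ)) ^ 3 := pow_le_pow_left₀ hlog0.le hlog 3
      _ = L ^ (3 / 4 : ℝ) := by
          rw [← Real.rpow_natCast, ← Real.rpow_mul hL0.le]; norm_num
  have h74 : L ^ (3 / 4 : ℝ) * L = L ^ (7 / 4 : ℝ) := by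
    rw [show (7 / 4 : ℝ) = 3 / 4 + 1 by norm_num, Real.rpow_add_one hL0.ne']
  have h1' : L ^ (3 / 4 : ℝ) * L ^ (1 / 4 : ℝ) = L := by
    rw [← Real.rpow_add hL0]; norm_num
  -- the exponent: `L^{3/4}/12 ≤ L/(12 log L)`
  have hexpo : 1 / 12 * L ^ (3 / 4 : ℝ) ≤ L / (12 * Real.log L) := by
    rw [le_div_iff₀ (by positivity)]
    calc 1 / 12 * L ^ (3 / 4 : ℝ) * (12 * Real.log L) = L ^ (3 / 4 : ℝ) * Real.log L := by ring
      _ ≤ L ^ (3 / 4 : ℝ) * L ^ (1 / 4 : ℝ) := mul_le_mul_of_nonneg_left hlog (by positivity)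
      _ = L := h1'
  have hmain : 54 * C * Real.log L ^ 3 * L ≤ Real.exp (L / (12 * Real.log L)) := by
    calc 54 * C * Real.log L ^ 3 * L ≤ 54 * C * L ^ (3 / 4 : ℝ) * L := by
          have : 0 ≤ 54 * C * L := by positivity
          nlinarith
      _ = 54 * C * L ^ (7 / 4 : ℝ) := by rw [mul_assoc, h74]
      _ ≤ Real.exp (1 / 12 * L ^ (3 / 4 : ℝ)) := hexp
      _ ≤ Real.exp (L / (12 * Real.log L)) := Real.exp_le_exp.2 hexpo
  rw [Real.exp_neg, mul_inv_le_iff₀ (Real.exp_pos _)]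
  calc 54 * C * Real.log L ^ 3 = 1 / L * (54 * C * Real.log L ^ 3 * L) := by field_simp
    _ ≤ 1 / L * Real.exp (L / (12 * Real.log L)) := mul_le_mul_of_nonneg_left hmain (by positivity)

/-- `exp(-u) (log T)² < 1` forces `u > 2 log log T` (`log T > 0`). [folklore] -/
theorem two_mul_log_lt_of_exp_mul_sq_lt {u lT : ℝ} (hlT : 0 < lT)
    (h : Real.exp (-u) * lT ^ 2 < 1) : 2 * Real.log lT < u := by
  have h1 : Real.exp (-u) * lT ^ 2 = Real.exp (-u + 2 * Real.log lT) := by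
    rw [Real.exp_add, show 2 * Real.log lT = Real.log lT + Real.log lT by ring, Real.exp_add,
      Real.exp_log hlT]
    ring
  rw [h1, Real.exp_lt_one_iff] at h
  linarith

/-! ### Thresholds -/

/-- Eventually in `X`: `c (log X)³ ≤ X`. [folklore] -/
theorem eventually_mul_log_pow_three_le (c : ℝ) : ∀ᶠ X : ℝ in atTop, c * Real.log X ^ 3 ≤ X := by
  have h := Real.tendsto_log_atTop.eventually
    (TwistedVonMangoldt.eventually_mul_rpow_le_exp c 3 one_pos one_pos)
  filter_upwards [h, eventually_gt_atTop (0 : ℝ)] with X hX hX0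
  rw [one_mul, Real.rpow_one, Real.exp_log hX0, show (3 : ℝ) = ((3 : ℕ) : ℝ) by norm_num,
    Real.rpow_natCast] at hX
  exact hX

/-- Eventually in `L`: `log L ≤ L^{1/4}`. [folklore] -/
theorem eventually_log_le_rpow_quarter : ∀ᶠ L : ℝ in atTop, Real.log L ≤ L ^ (1 / 4 : ℝ) := by
  have h := (isLittleO_log_rpow_atTop (show (0 : ℝ) < 1 / 4 by norm_num)).bound (show (0 : ℝ) < 1 by norm_num)
  filter_upwards [h, eventually_ge_atTop (1 : ℝ)] with L hL hL1
  rw [one_mul, Real.norm_of_nonneg (Real.log_nonneg hL1),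
    Real.norm_of_nonneg (Real.rpow_nonneg (by linarith) _)] at hL
  exact hL

/-! ### Lemma 11 from a Vinogradov–Korobov zero-free region (any constant), and from Khale's -/

set_option maxHeartbeats 1600000 in
/-- **Matomäki–Radziwiłł 2016, Lemma 11, from the Vinogradov–Korobov zero-free region** in the inexplicit
interface form `HasVKZeroFreeRegion c T₀` of `VinogradovKorobovDirichlet.lean` (`c > 0`, any starting height;
explicit or not).  Then for every `ε > 0` there is `C` such that for
`P, T ≥ 2`, every `1`-spaced `𝒯 ⊂ [-T, T]` and all coefficients `a_p`,
`∑_{t ∈ 𝒯} |∑_{P ≤ p ≤ 2P} a_p p^{-it}|² ≤ C (P + |𝒯| P exp(-log P/(log T)^{2/3+ε}) (log T)²) ∑_p |a_p|²/log P`,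
i.e. the named fact `MatomakiRadziwill2016_lemma11` holds.  See the module docstring for the proof (the
analytic input `TwistedVonMangoldt.exists_twistData_of_vk` is the only place where the region enters).
[cite: MatomakiRadziwillAnnals2016, Lemma 11] [cite: Khale2024, (1.4)] -/
theorem _root_.Literature.NumberTheory.Sieve.MatomakiRadziwill2016_lemma11_of_vk {cVK TVK : ℝ}
    (hcVK : 0 < cVK) (hVK : HasVKZeroFreeRegion cVK TVK) : MatomakiRadziwill2016_lemma11 := by
  intro ε hε
  classical
  -- exponents
  set ε' : ℝ := min ε (1 / 2) with hε'def
  have hε'0 : 0 < ε' := lt_min hε (by norm_num)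
  have hε'ε : ε' ≤ ε := min_le_left _ _
  have hε'h : ε' ≤ 1 / 2 := min_le_right _ _
  have hε'ne : ε' ≠ 0 := hε'0.ne'
  set η : ℝ := 2 / 3 + ε' / 2 with hηdef
  have hη23 : 2 / 3 < η := by rw [hηdef]; linarith
  have hη1 : η ≤ 1 := by rw [hηdef]; linarith
  have hη0 : 0 < η := by linarith
  -- the analytic input at a scale `X`, and the absolute Dirichlet-series bound `K₀`
  obtain ⟨C, hC0, hev⟩ := TwistedVonMangoldt.exists_twistData_of_vk hcVK hVK one_pos hη23 hη1
  obtain ⟨K₀, hK₀, hKL⟩ := TwistedRieszMean.exists_norm_LSeries_le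
  have hevX := (hev.and (eventually_mul_log_pow_three_le (2 * C))).and
    ((Real.tendsto_log_atTop.eventually_ge_atTop (1 : ℝ)).and (eventually_ge_atTop (1 : ℝ)))
  obtain ⟨X₃, hX₃⟩ := Filter.eventually_atTop.1 hevX
  have hX₃1 : 1 ≤ X₃ := (hX₃ X₃ le_rfl).2.2
  set A₀ : ℝ := Real.log X₃ + Real.log 2 + Real.log (4 + K₀) with hA₀def
  -- thresholds in `L = log P` (case `log P > T`)
  have hevL := ((eventually_log_le_rpow_quarter.and
    (TwistedVonMangoldt.eventually_mul_rpow_le_exp (54 * C) (7 / 4) (show (0 : ℝ) < 1 / 12 by norm_num)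
      (show (0 : ℝ) < 3 / 4 by norm_num))).and
    ((eventually_ge_atTop (Real.exp A₀)).and ((eventually_ge_atTop (Real.log 16)).and
      (eventually_ge_atTop (4 : ℝ)))))
  obtain ⟨L₀, hL₀⟩ := Filter.eventually_atTop.1 hevL
  -- the threshold in `T`
  set T₀ : ℝ := max (Real.exp A₀) (max (Real.exp (18 ^ (2 / ε'))) (max (Real.exp (Real.exp 1))
    (Real.exp (Real.exp (max L₀ 0 / 2))))) with hT₀def
  have hT₀0 : 0 ≤ T₀ := le_trans (Real.exp_pos _).le (le_max_left _ _)
  -- the constant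
  set Cf : ℝ := 276 + 23 * (54 * C + 1) + 2 * Real.log 4 * (2 * T₀ + 1) + 2 * Real.log 4 with hCfdef
  have hlog4 : 0 ≤ Real.log 4 := Real.log_nonneg (by norm_num)
  have hprod : 0 ≤ Real.log 4 * T₀ := mul_nonneg hlog4 hT₀0
  have hCf1 : 276 ≤ Cf := by rw [hCfdef]; linarith
  have hCf2 : 23 * (54 * C + 1) ≤ Cf := by rw [hCfdef]; linarith
  have hCf3 : 2 * Real.log 4 * (2 * T₀ + 1) ≤ Cf := by rw [hCfdef]; linarith
  have hCf4 : 2 * Real.log 4 ≤ Cf := by rw [hCfdef]; linarith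
  have hCf0 : 0 ≤ Cf := le_trans (by norm_num) hCf1
  refine ⟨Cf, ?_⟩
  intro P T a 𝒯 hP hT h𝒯T hsep
  -- notation
  set S := (Icc ⌈P⌉₊ ⌊2 * P⌋₊).filter Nat.Prime with hSdef
  set Asum : ℝ := ∑ p ∈ S, ‖a p‖ ^ 2 / Real.log P with hAsumdef
  set lT : ℝ := Real.log T with hlTdef
  set lP : ℝ := Real.log P with hlPdef
  set E : ℝ := Real.exp (-(lP / lT ^ (2 / 3 + ε))) with hEdef
  set LHS : ℝ := ∑ t ∈ 𝒯, ‖∑ p ∈ S, a p * (p : ℂ) ^ (-((t : ℂ) * I))‖ ^ 2 with hLHSdef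
  have hP1 : 1 < P := by linarith
  have hP0 : 0 < P := by linarith
  have hlP0 : 0 < lP := Real.log_pos hP1
  have hlT0 : 0 < lT := Real.log_pos (by linarith)
  have hE0 : 0 < E := Real.exp_pos _
  have hAsum0 : 0 ≤ Asum := Finset.sum_nonneg fun p _ => div_nonneg (sq_nonneg _) hlP0.le
  have hcard : (#𝒯 : ℝ) ≤ 2 * T + 1 := card_le_of_wellSpaced (by linarith) h𝒯T hsep
  have hcard0 : (0 : ℝ) ≤ #𝒯 := Nat.cast_nonneg _
  have hRHS0 : 0 ≤ (#𝒯 : ℝ) * P * E * lT ^ 2 := by positivity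
  change LHS ≤ Cf * (P + (#𝒯 : ℝ) * P * E * lT ^ 2) * Asum
  have htb : LHS ≤ (#𝒯 : ℝ) * (2 * Real.log 4 * P) * Asum := trivial_bound hP1 a 𝒯
  by_cases hmain : 2 * T₀ + 1 < (#𝒯 : ℝ) ∧ E * lT ^ 2 < 1
  · -- **the main regime**
    obtain ⟨hcardT₀, hEsmall⟩ := hmain
    have hTT₀ : T₀ < T := by linarith
    have hT1 : 1 ≤ T := by linarith
    -- consequences of `T > T₀`
    have hTexp : ∀ y : ℝ, Real.exp y ≤ T₀ → y < lT := fun y hy => by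
      rw [hlTdef, Real.lt_log_iff_exp_lt (by linarith)]; linarith
    have hlTA₀ : A₀ < lT := hTexp _ (le_max_left _ _)
    have hlT18 : (18 : ℝ) ^ (2 / ε') < lT := hTexp _ ((le_max_left _ _).trans (le_max_right _ _))
    have hlTe : Real.exp 1 < lT :=
      hTexp _ (((le_max_left _ _).trans (le_max_right _ _)).trans (le_max_right _ _))
    have hlTL₀ : Real.exp (max L₀ 0 / 2) < lT :=
      hTexp _ (((le_max_right _ _).trans (le_max_right _ _)).trans (le_max_right _ _))
    have hlT1 : 1 ≤ lT := by have := Real.add_one_le_exp (1 : ℝ); linarith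
    have hllT1 : 1 < Real.log lT := by
      rw [Real.lt_log_iff_exp_lt hlT0]; exact hlTe
    have h18 : 18 ≤ lT ^ (ε' / 2) := by
      have h' : ((18 : ℝ) ^ (2 / ε')) ^ (ε' / 2) ≤ lT ^ (ε' / 2) :=
        Real.rpow_le_rpow (by positivity) hlT18.le (by positivity)
      rwa [← Real.rpow_mul (by norm_num), show 2 / ε' * (ε' / 2) = 1 by field_simp,
        Real.rpow_one] at h'
    -- `u` and the lower bound for `log P`
    set u : ℝ := lP / lT ^ (2 / 3 + ε) with hudef
    have hu : 2 * Real.log lT < u := by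
      apply two_mul_log_lt_of_exp_mul_sq_lt hlT0
      exact hEsmall
    have hu0 : 0 ≤ u := by linarith
    have hpow1 : 1 ≤ lT ^ (2 / 3 + ε) := Real.one_le_rpow hlT1 (by linarith)
    have hlPu : u ≤ lP := by
      have : lP = u * lT ^ (2 / 3 + ε) := by
        rw [hudef, div_mul_cancel₀ _ (by positivity)]
      rw [this]
      exact le_mul_of_one_le_right hu0 hpow1
    have hlPlb : 2 * Real.log lT < lP := lt_of_lt_of_le hu hlPu
    have hloglT : max L₀ 0 / 2 < Real.log lT := by
      rw [Real.lt_log_iff_exp_lt hlT0]; exact hlTL₀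
    have hlPL₀ : max L₀ 0 < lP := by linarith
    have hL₀P := hL₀ lP ((le_max_left _ _).trans hlPL₀.le)
    obtain ⟨⟨hlogquarter, hexp74⟩, hA₀lP, h16, hlP4⟩ := hL₀P
    have hP16 : 16 ≤ P := by
      rw [hlPdef, Real.le_log_iff_exp_le hP0] at h16
      -- `h16 : exp (log 16) ≤ P`
      simpa [Real.exp_log (show (0 : ℝ) < 16 by norm_num)] using h16
    have hP4 : 4 ≤ P := by linarith
    have hlP1 : 1 ≤ lP := by linarith
    have hllPA₀ : A₀ ≤ Real.log lP := by
      rw [Real.le_log_iff_exp_le hlP0]; exact hA₀lP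
    -- the scale `X`
    set LP : ℝ := 2 * lP + 2 + K₀ with hLPdef
    have hLP2 : 2 ≤ LP := by rw [hLPdef]; linarith
    set X : ℝ := max X₃ (2 * T * LP) with hXdef
    have hX₃X : X₃ ≤ X := le_max_left _ _
    obtain ⟨⟨hTDX, hClogX⟩, hlogX1, hX1⟩ := hX₃ X hX₃X
    have hX0 : 0 < X := by linarith
    have hX2T : 2 * T * LP ≤ X := le_max_right _ _
    have h2TX : 2 * T ≤ X :=
      le_trans (le_mul_of_one_le_right (by linarith) (by linarith : (1 : ℝ) ≤ LP)) hX2T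
    -- `TwistData` for every shift `t - t'`
    have hTD : ∀ t ∈ 𝒯, ∀ t' ∈ 𝒯,
        TwistData (TwistedVonMangoldt.twist (1 : DirichletCharacter ℂ 1) (t - t'))
          (TwistedVonMangoldt.G (1 : DirichletCharacter ℂ 1) (t - t'))
          (TwistedVonMangoldt.delta (1 : DirichletCharacter ℂ 1)) (1 - ((t - t' : ℝ) : ℂ) * I)
          (1 - Real.log X ^ (-η) / 2) X (C * Real.log X ^ 3) := by
      intro t ht t' ht'
      have hτ : |t - t'| ≤ X := by
        calc |t - t'| ≤ |t| + |t'| := abs_sub _ _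
          _ ≤ T + T := add_le_add (h𝒯T t ht) (h𝒯T t' ht')
          _ ≤ X := by linarith
      have hq : ((1 : ℕ) : ℝ) ≤ Real.log X ^ (1 : ℝ) := by
        rw [Real.rpow_one, Nat.cast_one]; exact hlogX1
      exact hTDX 1 hq 1 (t - t') hτ X hX1 le_rfl
    -- the uniform part `U` of the kernel bound
    set F₀ : ℝ := 2 * (C * Real.log X ^ 3) * (P / 2) ^ ((1 - Real.log X ^ (-η) / 2) - 1) with hF₀def
    have hF₀0 : 0 ≤ F₀ := by rw [hF₀def]; positivity
    set U : ℝ := 1 / T + F₀ with hUdef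
    have hU0 : 0 ≤ U := by rw [hUdef]; positivity
    have h2T0 : (0 : ℝ) < 2 * T := by linarith
    have hU : LP / X + F₀ + 2 * (C * Real.log X ^ 3) / X ^ 2 ≤ U := by
      have h1 : LP / X ≤ 1 / (2 * T) := by
        rw [div_le_div_iff₀ hX0 h2T0]
        linarith
      have h2 : 2 * (C * Real.log X ^ 3) / X ^ 2 ≤ 1 / (2 * T) := by
        rw [div_le_div_iff₀ (pow_pos hX0 2) h2T0]
        calc 2 * (C * Real.log X ^ 3) * (2 * T) = (2 * C * Real.log X ^ 3) * (2 * T) := by ring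
          _ ≤ X * (2 * T) := mul_le_mul_of_nonneg_right hClogX h2T0.le
          _ ≤ X * X := mul_le_mul_of_nonneg_left h2TX hX0.le
          _ = 1 * X ^ 2 := by ring
      have h3 : 1 / (2 * T) + 1 / (2 * T) = 1 / T := by ring
      rw [hUdef, ← h3]
      linarith
    -- **the Dirichlet-polynomial bound with the parameter `U`**
    have hDB : LHS ≤ 23 * P * (6 + (#𝒯 : ℝ) * U) * Asum :=
      dirichlet_bound hsep hTD hK₀ hKL hP16 hU0 hU a
    -- the saving in exponential form and the size of `log X`
    have hF₀exp : F₀ = 2 * C * Real.log X ^ 3 *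
        Real.exp (-(Real.log (P / 2) * (Real.log X ^ (-η) / 2))) := by
      rw [hF₀def, rpow_sigma_eq hP0]; ring
    have hlogX : Real.log X ≤ A₀ + lT + Real.log lP := by
      have h1 := log_scale_le hX₃1 hT1 (by linarith : (1 : ℝ) ≤ LP)
      have h2 := log_LP_le hlP1 hK₀
      rw [hXdef, hA₀def]
      linarith
    have hcard3 : (#𝒯 : ℝ) * (1 / T) ≤ 3 := by
      rw [mul_one_div, div_le_iff₀ (by linarith)]; linarith
    by_cases hcase : Real.log lP ≤ lT
    · -- **case (i): `log P ≤ T`**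
      have hlogX3 : Real.log X ≤ 3 * lT := by linarith
      have hsave := saving_case_i hP4 hlogX1 hlogX3 hlT1 hη0 hη1
      have hA := key_exponent_ineq hlT1 h18 hηdef hε'ε hudef hu0
      have hnum := numerics_case_i hC0 hlT1 hu hA
      have hF₀le : F₀ ≤ (54 * C + 1) * lT ^ 2 * E := by
        have h1 : Real.log X ^ 3 ≤ (3 * lT) ^ 3 := pow_le_pow_left₀ (by linarith) hlogX3 3
        calc F₀ = 2 * C * Real.log X ^ 3 *
              Real.exp (-(Real.log (P / 2) * (Real.log X ^ (-η) / 2))) := hF₀exp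
          _ ≤ 2 * C * (3 * lT) ^ 3 * Real.exp (-(lP / (12 * lT ^ η))) := by
              refine mul_le_mul ?_ hsave (Real.exp_pos _).le (by positivity)
              exact mul_le_mul_of_nonneg_left h1 (by positivity)
          _ = 54 * C * lT ^ 3 * Real.exp (-(lP / (12 * lT ^ η))) := by ring
          _ ≤ (54 * C + 1) * lT ^ 2 * Real.exp (-u) := hnum
          _ = (54 * C + 1) * lT ^ 2 * E := by simp only [hEdef, hudef]
      have hTU : (#𝒯 : ℝ) * U ≤ 3 + (54 * C + 1) * ((#𝒯 : ℝ) * E * lT ^ 2) := by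
        rw [hUdef, mul_add]
        have : (#𝒯 : ℝ) * F₀ ≤ (#𝒯 : ℝ) * ((54 * C + 1) * lT ^ 2 * E) :=
          mul_le_mul_of_nonneg_left hF₀le hcard0
        linarith
      calc LHS ≤ 23 * P * (6 + (#𝒯 : ℝ) * U) * Asum := hDB
        _ ≤ 23 * P * (9 + (54 * C + 1) * ((#𝒯 : ℝ) * E * lT ^ 2)) * Asum := by
            apply mul_le_mul_of_nonneg_right _ hAsum0
            apply mul_le_mul_of_nonneg_left _ (by positivity)
            linarith
        _ = (207 * P + 23 * (54 * C + 1) * ((#𝒯 : ℝ) * P * E * lT ^ 2)) * Asum := by ring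
        _ ≤ (Cf * P + Cf * ((#𝒯 : ℝ) * P * E * lT ^ 2)) * Asum := by
            apply mul_le_mul_of_nonneg_right _ hAsum0
            apply add_le_add
            · exact mul_le_mul_of_nonneg_right (le_trans (by norm_num) hCf1) hP0.le
            · exact mul_le_mul_of_nonneg_right hCf2 hRHS0
        _ = Cf * (P + (#𝒯 : ℝ) * P * E * lT ^ 2) * Asum := by ring
    · -- **case (ii): `log P > T`**
      push Not at hcase
      have hllP3 : 1 ≤ 3 * Real.log lP := by linarith
      have hlogX3 : Real.log X ≤ 3 * Real.log lP := by linarith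
      have hsave := saving_case_ii hP4 hlogX1 hlogX3 hllP3 hη0 hη1
      have hnum := numerics_case_ii hC0 (by linarith : (1 : ℝ) < lP) hlogquarter hexp74
      have hF₀le : F₀ ≤ 1 / T := by
        have h1 : Real.log X ^ 3 ≤ (3 * Real.log lP) ^ 3 := pow_le_pow_left₀ (by linarith) hlogX3 3
        have hTlP : T < lP := by
          calc T = Real.exp lT := (Real.exp_log (by linarith)).symm
            _ < Real.exp (Real.log lP) := Real.exp_lt_exp.2 hcase
            _ = lP := Real.exp_log hlP0
        calc F₀ = 2 * C * Real.log X ^ 3 *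
              Real.exp (-(Real.log (P / 2) * (Real.log X ^ (-η) / 2))) := hF₀exp
          _ ≤ 2 * C * (3 * Real.log lP) ^ 3 * Real.exp (-(lP / (12 * Real.log lP))) := by
              refine mul_le_mul ?_ hsave (Real.exp_pos _).le (by positivity)
              exact mul_le_mul_of_nonneg_left h1 (by positivity)
          _ = 54 * C * Real.log lP ^ 3 * Real.exp (-(lP / (12 * Real.log lP))) := by ring
          _ ≤ 1 / lP := hnum
          _ ≤ 1 / T := one_div_le_one_div_of_le (by linarith) hTlP.le
      have hTU : (#𝒯 : ℝ) * U ≤ 6 := by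
        rw [hUdef, mul_add]
        have : (#𝒯 : ℝ) * F₀ ≤ (#𝒯 : ℝ) * (1 / T) := mul_le_mul_of_nonneg_left hF₀le hcard0
        linarith
      calc LHS ≤ 23 * P * (6 + (#𝒯 : ℝ) * U) * Asum := hDB
        _ ≤ 23 * P * 12 * Asum := by
            apply mul_le_mul_of_nonneg_right _ hAsum0
            apply mul_le_mul_of_nonneg_left _ (by positivity)
            linarith
        _ = 276 * P * Asum := by ring
        _ ≤ Cf * (P + (#𝒯 : ℝ) * P * E * lT ^ 2) * Asum := by
            apply mul_le_mul_of_nonneg_right _ hAsum0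
            calc 276 * P ≤ Cf * P := mul_le_mul_of_nonneg_right hCf1 hP0.le
              _ ≤ Cf * (P + (#𝒯 : ℝ) * P * E * lT ^ 2) :=
                  mul_le_mul_of_nonneg_left (by linarith) hCf0
  · -- **the trivial regimes**: few points, or the second term dominates
    rcases not_and_or.1 hmain with h1 | h2
    · push Not at h1
      calc LHS ≤ (#𝒯 : ℝ) * (2 * Real.log 4 * P) * Asum := htb
        _ ≤ (2 * T₀ + 1) * (2 * Real.log 4 * P) * Asum := by
            apply mul_le_mul_of_nonneg_right _ hAsum0
            exact mul_le_mul_of_nonneg_right h1 (by positivity)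
        _ = (2 * Real.log 4 * (2 * T₀ + 1)) * P * Asum := by ring
        _ ≤ Cf * P * Asum := by
            apply mul_le_mul_of_nonneg_right _ hAsum0
            exact mul_le_mul_of_nonneg_right hCf3 hP0.le
        _ ≤ Cf * (P + (#𝒯 : ℝ) * P * E * lT ^ 2) * Asum := by
            apply mul_le_mul_of_nonneg_right _ hAsum0
            exact mul_le_mul_of_nonneg_left (by linarith) hCf0
    · push Not at h2
      calc LHS ≤ (#𝒯 : ℝ) * (2 * Real.log 4 * P) * Asum := htb
        _ ≤ (#𝒯 : ℝ) * (2 * Real.log 4 * P) * (E * lT ^ 2) * Asum := by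
            apply mul_le_mul_of_nonneg_right _ hAsum0
            exact le_mul_of_one_le_right (by positivity) h2
        _ = 2 * Real.log 4 * ((#𝒯 : ℝ) * P * E * lT ^ 2) * Asum := by ring
        _ ≤ Cf * ((#𝒯 : ℝ) * P * E * lT ^ 2) * Asum := by
            apply mul_le_mul_of_nonneg_right _ hAsum0
            exact mul_le_mul_of_nonneg_right hCf4 hRHS0
        _ ≤ Cf * (P + (#𝒯 : ℝ) * P * E * lT ^ 2) * Asum := by
            apply mul_le_mul_of_nonneg_right _ hAsum0
            exact mul_le_mul_of_nonneg_left (by linarith) hCf0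

/-- **Matomäki–Radziwiłł 2016, Lemma 11, from Khale's explicit Vinogradov–Korobov zero-free region**
(`Khale2024_zeroFreeRegion`, i.e. `HasVKZeroFreeRegion (1/61.5) 10`): the specialisation of
`MatomakiRadziwill2016_lemma11_of_vk`. [cite: MatomakiRadziwillAnnals2016, Lemma 11] [cite: Khale2024, Theorem 1.1] -/
theorem _root_.Literature.NumberTheory.Sieve.MatomakiRadziwill2016_lemma11_of_khale
    (hK : Khale2024_zeroFreeRegion) : MatomakiRadziwill2016_lemma11 :=
  MatomakiRadziwill2016_lemma11_of_vk (by norm_num) (hasVKZeroFreeRegion_of_khale hK)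

end MatomakiRadziwillL11

end Literature.NumberTheory.Sieve
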